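import Summits.QuantumFields.QCD.Theses.PauliWegnerSea
import Summits.QuantumFields.QCD.Theorems.PauliWegnerSeaPauliBandLimitDetRank
import Literature.MathematicalPhysics.QuantumLattice.GrassmannIntegralProofs

/-!
# Route `PauliWegnerSea`, item `PauliBandLimit` (stmt-QuantumFields-11514, support, card P1)

**Claim.** For every torus `(ℤ/L)⁴`, every `SU(3)` background `U`, bare mass `m₀`, edge
`e = (x, μ₀)` and every one-parameter family `T(θ) ∈ SU(3)` with matrix
`diag(e^{iθ}, e^{-iθ}, 1)`, the function `θ ↦ det D_W(U[U_e ↦ U_e T(θ)]; m₀, r = 1)` of the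
tree's Wilson–Dirac matrix `wilsonDirac (fundamentalRep (Fin 3))` is a trigonometric polynomial
of degree `≤ 4`: `= ∑_{k=0}^{8} c_k e^{i(k-4)θ}` ("at most two quark lines per colour cross a
link each way").

**Proof.**
* *Abstract part* (sibling file `PauliWegnerSeaPauliBandLimitDetRank`,
  `det_add_smul_add_smul_of_rank_le`): if `rank B ≤ r`, `rank C ≤ s` and `z w = 1` then
  `det (A + z B + w C) = w^s ∑_{k ≤ r+s} c_k z^k` with coefficients independent of `z, w`
  (row-multilinear expansion of `det`; a term with more than `rank B` rows from `B` vanishes).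
* *Structure part* (`wilsonDirac_update_decomp`, here): with `z = e^{iθ}`, `w = e^{-iθ} = z̄`,
  `D_W(U[U_e ↦ U_e T(θ)]) = A + z B + w C` entrywise — `wilsonDirac_update_apply` isolates the
  two hops through `e`; `U_e T = U_e diag(z, w, 1)` scales the colour COLUMNS of the forward hop
  `-½ (1 - γ_{μ₀}) ⊗ U_e` by `(z, w, 1)`, and `(U_e T)⁻¹ = diag(w, z, 1) U_e†` scales the colour
  ROWS of the backward hop `-½ (1 + γ_{μ₀}) ⊗ U_e†` by `(w, z, 1)` — where `B` = (colour column
  `0` of the forward hop) + (colour row `1` of the backward hop), and symmetrically for `C`.  Each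
  of these four pieces is `(vector) ⊗ (1 ∓ γ_{μ₀})`, and `1 ∓ γ_{μ₀}` has rank two: in the chiral
  basis `γ_μ = (0, M; M†, 0)` with `M` unitary, so `1 ∓ γ_μ = (1; ∓M†)(1, ∓M)` factors through its
  first two rows/columns (`oneSubGamma_apply_eq`, `oneAddGamma_apply_eq`, checked on the explicit
  matrices `euclideanGamma_zero` … `euclideanGamma_three`).  Hence `B, C` are sums of two products
  through `Fin 2`, and `rank B, rank C ≤ 4`.
* *Assembly* (`PauliBandLimit_proof`): `r = s = 4`, `w⁴ z^k = e^{i(k-4)θ}`.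

No hypothesis `4 ≤ L` is needed (for `L ≤ 2` the two hops through `e` may land in entries also
fed by other links or by each other; the entrywise bookkeeping is insensitive to this), and
`r = 1` is essential (for `r ≠ ±1` the spin factors `r ∓ γ_μ` are invertible and the degree is
`12`).  Consistent with the card's kit certificate j002689 and the refuter numerics attached to
the item (degree exactly `4`).

References: I. Montvay, G. Münster, *Quantum Fields on a Lattice* (CUP 1994), §4.2.2 (4.85),
§5.1.1 (5.5), App. 8.1.2 (8.8)–(8.10) [MontvayMunster1994]; the card's sources
[doi:10.1103/physrevd.63.114502, arXiv:hep-lat/0203026] for the "six quark lines per link"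
band limit of the Wilson sea.
-/

open scoped BigOperators
open Matrix Complex Finset
open Literature.MathematicalPhysics.QuantumFieldTheory Literature.MathematicalPhysics.QuantumLattice
  Literature.Probability.LatticeModels

namespace Summit.QuantumFields.QCD.Theorems.PauliBandLimit

/-- `SU(3)` as a submonoid of `3 × 3` complex matrices. -/
local notation "SU3" => Matrix.specialUnitaryGroup (Fin 3) ℂ

/-- Algebraic skeleton of the link isolation: splitting each hopping term into its part off the
link `e` and its part through `e`, the latter survive only in direction `μ₀ = e.2`. [folklore] -/
theorem entry_split {ι : Type*} [Fintype ι] [DecidableEq ι] (M c : ℂ) (f₀ g₀ f₁ g₁ : ι → ℂ)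
    (μ₀ : ι) (hf₁ : ∀ μ, μ ≠ μ₀ → f₁ μ = 0) (hg₁ : ∀ μ, μ ≠ μ₀ → g₁ μ = 0) :
    M - c * ∑ μ, ((f₀ μ + f₁ μ) + (g₀ μ + g₁ μ)) =
      (M - c * ∑ μ, (f₀ μ + g₀ μ)) + (-c * f₁ μ₀) + (-c * g₁ μ₀) := by
  have h1 : ∑ μ, ((f₀ μ + f₁ μ) + (g₀ μ + g₁ μ)) =
      ∑ μ, (f₀ μ + g₀ μ) + ∑ μ, f₁ μ + ∑ μ, g₁ μ := by
    simp only [Finset.sum_add_distrib]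
    ring
  rw [h1, Finset.sum_eq_single μ₀ (fun μ _ h => hf₁ μ h) (by simp),
    Finset.sum_eq_single μ₀ (fun μ _ h => hg₁ μ h) (by simp)]
  ring

variable {L : ℕ}

/-- **Link isolation.** The entries of the `r = 1` Wilson–Dirac matrix of the configuration
`U` with the link `e = (x, μ₀)` replaced by `g`: the `g`-independent part (mass term and all hops
not through `e`) plus the forward hop `x → x + μ̂₀` carrying `-½ (1 - γ_{μ₀}) ⊗ g` and the backward
hop carrying `-½ (1 + γ_{μ₀}) ⊗ g⁻¹ = -½ (1 + γ_{μ₀}) ⊗ g†`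
(Montvay–Münster (4.85)/(5.5)). [folklore] -/
theorem wilsonDirac_update_apply (U : GaugeConfig 4 L SU3) (m₀ : ℝ) (e : Edge 4 L) (g : SU3)
    (p q : TorusSite 4 L × Fin 3 × Fin 4) :
    wilsonDirac (fundamentalRep (Fin 3)) (Function.update U e g) m₀ 1 p q =
      ((if p = q then ((m₀ + 4 : ℝ) : ℂ) else 0) -
        (1 / 2 : ℂ) * ∑ μ : Fin 4,
          ((if q.1 = Site.shift p.1 μ ∧ (p.1, μ) ≠ e then
              (1 - euclideanGamma μ) p.2.2 q.2.2 *
                (U (p.1, μ) : Matrix (Fin 3) (Fin 3) ℂ) p.2.1 q.2.1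
            else 0) +
           (if p.1 = Site.shift q.1 μ ∧ (q.1, μ) ≠ e then
              (1 + euclideanGamma μ) p.2.2 q.2.2 *
                star ((U (q.1, μ) : Matrix (Fin 3) (Fin 3) ℂ) q.2.1 p.2.1)
            else 0))) +
      (-(1 / 2 : ℂ) * (if q.1 = Site.shift e.1 e.2 ∧ p.1 = e.1 then
          (1 - euclideanGamma e.2) p.2.2 q.2.2 * (g : Matrix (Fin 3) (Fin 3) ℂ) p.2.1 q.2.1
        else 0)) +
      (-(1 / 2 : ℂ) * (if p.1 = Site.shift e.1 e.2 ∧ q.1 = e.1 then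
          (1 + euclideanGamma e.2) p.2.2 q.2.2 * star ((g : Matrix (Fin 3) (Fin 3) ℂ) q.2.1 p.2.1)
        else 0)) := by
  simp only [wilsonDirac, Matrix.of_apply, Function.update_apply, fundamentalRep_apply,
    Complex.ofReal_one, one_smul, mul_one]
  have hf : ∀ μ : Fin 4,
      (if q.1 = Site.shift p.1 μ then
          (1 - euclideanGamma μ) p.2.2 q.2.2 *
            ((if (p.1, μ) = e then g else U (p.1, μ) : SU3) : Matrix (Fin 3) (Fin 3) ℂ) p.2.1 q.2.1
        else 0) =
        (if q.1 = Site.shift p.1 μ ∧ (p.1, μ) ≠ e then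
            (1 - euclideanGamma μ) p.2.2 q.2.2 * (U (p.1, μ) : Matrix (Fin 3) (Fin 3) ℂ) p.2.1 q.2.1
          else 0) +
        (if q.1 = Site.shift p.1 μ ∧ (p.1, μ) = e then
            (1 - euclideanGamma μ) p.2.2 q.2.2 * (g : Matrix (Fin 3) (Fin 3) ℂ) p.2.1 q.2.1
          else 0) := by
    intro μ
    by_cases h1 : q.1 = Site.shift p.1 μ <;> by_cases h2 : (p.1, μ) = e <;> simp [h1, h2]
  have hg : ∀ μ : Fin 4,
      (if p.1 = Site.shift q.1 μ then
          (1 + euclideanGamma μ) p.2.2 q.2.2 *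
            (((if (q.1, μ) = e then g else U (q.1, μ) : SU3)⁻¹ : SU3) : Matrix (Fin 3) (Fin 3) ℂ)
              p.2.1 q.2.1
        else 0) =
        (if p.1 = Site.shift q.1 μ ∧ (q.1, μ) ≠ e then
            (1 + euclideanGamma μ) p.2.2 q.2.2 *
              star ((U (q.1, μ) : Matrix (Fin 3) (Fin 3) ℂ) q.2.1 p.2.1)
          else 0) +
        (if p.1 = Site.shift q.1 μ ∧ (q.1, μ) = e then
            (1 + euclideanGamma μ) p.2.2 q.2.2 * star ((g : Matrix (Fin 3) (Fin 3) ℂ) q.2.1 p.2.1)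
          else 0) := by
    intro μ
    have hinv : ∀ k : SU3, ((k⁻¹ : SU3) : Matrix (Fin 3) (Fin 3) ℂ) p.2.1 q.2.1 =
        star ((k : Matrix (Fin 3) (Fin 3) ℂ) q.2.1 p.2.1) := fun k => rfl
    by_cases h1 : p.1 = Site.shift q.1 μ <;> by_cases h2 : (q.1, μ) = e <;> simp [h1, h2, hinv]
  simp_rw [hf, hg]
  refine (entry_split _ _ _ _ _ _ e.2 (fun μ hμ => ?_) (fun μ hμ => ?_)).trans ?_
  · have : (p.1, μ) ≠ e := fun h => hμ (congrArg Prod.snd h)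
    simp [this]
  · have : (q.1, μ) ≠ e := fun h => hμ (congrArg Prod.snd h)
    simp [this]
  · congr 2
    · by_cases hp : p.1 = e.1
      · simp [hp]
      · have he : (p.1, e.2) ≠ e := fun h => hp (congrArg Prod.fst h)
        simp [hp, he]
    · by_cases hq : q.1 = e.1
      · simp [hq]
      · have he : (q.1, e.2) ≠ e := fun h => hq (congrArg Prod.fst h)
        simp [hq, he]


/-- Entries of the product of the rank-two factors: if `Γ_{αβ} = Γ_{α0}Γ_{0β} + Γ_{α1}Γ_{1β}` then
`(φ ⊗ Γ_{·,0..1}) (Γ_{0..1,·} ⊗ ψ) = φ ψ Γ`. [folklore] -/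
theorem of_mul_of_apply (Γ : Matrix (Fin 4) (Fin 4) ℂ)
    (hΓ : ∀ α β, Γ α β = Γ α 0 * Γ 0 β + Γ α 1 * Γ 1 β) {m n : Type*} (φ : m → ℂ)
    (a : m → Fin 4) (ψ : n → ℂ) (b : n → Fin 4) (p : m) (q : n) :
    ((Matrix.of fun (p : m) (δ : Fin 2) => φ p * ![Γ (a p) 0, Γ (a p) 1] δ) *
        (Matrix.of fun (δ : Fin 2) (q : n) => ![Γ 0 (b q), Γ 1 (b q)] δ * ψ q)) p q =
      φ p * ψ q * Γ (a p) (b q) := by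
  rw [Matrix.mul_apply, Fin.sum_univ_two, hΓ]
  simp
  ring

/-- The chiral factorisation of the Wilson projector `1 - γ_μ` through its first two rows and
columns: in the chiral basis `γ_μ = (0, M; M†, 0)` with `M` unitary, so
`1 - γ_μ = (1; -M†)·(1, -M)`. [folklore] -/
theorem oneSubGamma_apply_eq (μ α β : Fin 4) :
    (1 - euclideanGamma μ) α β =
      (1 - euclideanGamma μ) α 0 * (1 - euclideanGamma μ) 0 β +
        (1 - euclideanGamma μ) α 1 * (1 - euclideanGamma μ) 1 β := by
  fin_cases μ <;>
    simp only [Fin.zero_eta, Fin.mk_one, Fin.reduceFinMk, euclideanGamma_zero, euclideanGamma_one,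
      euclideanGamma_two, euclideanGamma_three] <;>
    fin_cases α <;> fin_cases β <;> norm_num [Matrix.sub_apply, Matrix.one_apply]

/-- The chiral factorisation of `1 + γ_μ = (1; M†)·(1, M)`. [folklore] -/
theorem oneAddGamma_apply_eq (μ α β : Fin 4) :
    (1 + euclideanGamma μ) α β =
      (1 + euclideanGamma μ) α 0 * (1 + euclideanGamma μ) 0 β +
        (1 + euclideanGamma μ) α 1 * (1 + euclideanGamma μ) 1 β := by
  fin_cases μ <;>
    simp only [Fin.zero_eta, Fin.mk_one, Fin.reduceFinMk, euclideanGamma_zero, euclideanGamma_one,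
      euclideanGamma_two, euclideanGamma_three] <;>
    fin_cases α <;> fin_cases β <;> norm_num [Matrix.add_apply, Matrix.one_apply]

/-- The forward hop through the rotated link `U_e · diag(z, w, 1)`, split by the colour column:
column `2` is `θ`-free, column `0` carries `z`, column `1` carries `w`. [folklore] -/
theorem fwd_hop_decomp (z w Γ : ℂ) (u : Fin 3 → ℂ) (b : Fin 3) (P Q : Prop) [Decidable P]
    [Decidable Q] :
    -(1 / 2 : ℂ) * (if Q ∧ P then Γ * (u b * ![z, w, 1] b) else 0) =
      (if P then -(1 / 2 : ℂ) * u 2 else 0) * (if Q ∧ b = 2 then 1 else 0) * Γ +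
        z * ((if P then -(1 / 2 : ℂ) * u 0 else 0) * (if Q ∧ b = 0 then 1 else 0) * Γ) +
        w * ((if P then -(1 / 2 : ℂ) * u 1 else 0) * (if Q ∧ b = 1 then 1 else 0) * Γ) := by
  by_cases hQ : Q
  · by_cases hP : P
    · fin_cases b
      · simp [hP, hQ]; ring
      · simp [hP, hQ]; ring
      · simp [hP, hQ]; ring
    · simp [hP, hQ]
  · simp [hQ]

/-- The backward hop through the rotated link, `(U_e diag(z, w, 1))⁻¹ = diag(w, z, 1) U_e†` on the
unit circle (`z̄ = w`), split by the colour row: row `2` is `θ`-free, row `1` carries `z`, row `0`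
carries `w`. [folklore] -/
theorem bwd_hop_decomp (z w Γ : ℂ) (hz : star z = w) (hw : star w = z) (v : Fin 3 → ℂ) (a : Fin 3)
    (P Q : Prop) [Decidable P] [Decidable Q] :
    -(1 / 2 : ℂ) * (if P ∧ Q then Γ * star (v a * ![z, w, 1] a) else 0) =
      (if P ∧ a = 2 then -(1 / 2 : ℂ) else 0) * (if Q then star (v 2) else 0) * Γ +
        z * ((if P ∧ a = 1 then -(1 / 2 : ℂ) else 0) * (if Q then star (v 1) else 0) * Γ) +
        w * ((if P ∧ a = 0 then -(1 / 2 : ℂ) else 0) * (if Q then star (v 0) else 0) * Γ) := by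
  have hz' : (starRingEnd ℂ) z = w := hz
  have hw' : (starRingEnd ℂ) w = z := hw
  by_cases hP : P
  · by_cases hQ : Q
    · fin_cases a
      · simp [hP, hQ, hz']; ring
      · simp [hP, hQ, hw']; ring
      · simp [hP, hQ]; ring
    · simp [hP, hQ]
  · simp [hP]

/-- **The one-link structure `D(θ) = A + e^{iθ} B + e^{-iθ} C` with `rank B, rank C ≤ 4`.**
Along `U_e ↦ U_e · diag(e^{iθ}, e^{-iθ}, 1)` the `r = 1` Wilson–Dirac matrix is
`A + e^{iθ} B + e^{-iθ} C`, where `B` (resp. `C`) is the colour-`0` (resp. `1`) column of the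
forward hop `-½ (1 - γ_{μ₀}) ⊗ U_e` plus the colour-`1` (resp. `0`) row of the backward hop
`-½ (1 + γ_{μ₀}) ⊗ U_e†`; each of these is (vector) ⊗ (rank-two projector), of rank `≤ 2`, by the
chiral factorisation `oneSubGamma_apply_eq` / `oneAddGamma_apply_eq`. [folklore] -/
theorem wilsonDirac_update_decomp [NeZero L] (U : GaugeConfig 4 L SU3) (m₀ : ℝ) (e : Edge 4 L)
    (T : ℝ → SU3)
    (hT : ∀ θ : ℝ, (T θ : Matrix (Fin 3) (Fin 3) ℂ) =
      Matrix.diagonal ![Complex.exp (θ * Complex.I), Complex.exp (-(θ * Complex.I)), 1]) :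
    ∃ A B C : Matrix (TorusSite 4 L × Fin 3 × Fin 4) (TorusSite 4 L × Fin 3 × Fin 4) ℂ,
      B.rank ≤ 4 ∧ C.rank ≤ 4 ∧ ∀ θ : ℝ,
        wilsonDirac (fundamentalRep (Fin 3)) (Function.update U e (U e * T θ)) m₀ 1 =
          A + Complex.exp (θ * Complex.I) • B + Complex.exp (-(θ * Complex.I)) • C := by
  -- forward factors (colour column `k`) and backward factors (colour row `k`)
  set fP : Fin 3 → Matrix (TorusSite 4 L × Fin 3 × Fin 4) (Fin 2) ℂ := fun k =>
    Matrix.of fun p δ =>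
      (if p.1 = e.1 then -(1 / 2 : ℂ) * (U e : Matrix (Fin 3) (Fin 3) ℂ) p.2.1 k else 0) *
        ![(1 - euclideanGamma e.2) p.2.2 0, (1 - euclideanGamma e.2) p.2.2 1] δ with hfP
  set fQ : Fin 3 → Matrix (Fin 2) (TorusSite 4 L × Fin 3 × Fin 4) ℂ := fun k =>
    Matrix.of fun δ q =>
      ![(1 - euclideanGamma e.2) 0 q.2.2, (1 - euclideanGamma e.2) 1 q.2.2] δ *
        (if q.1 = Site.shift e.1 e.2 ∧ q.2.1 = k then 1 else 0) with hfQ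
  set bP : Fin 3 → Matrix (TorusSite 4 L × Fin 3 × Fin 4) (Fin 2) ℂ := fun k =>
    Matrix.of fun p δ =>
      (if p.1 = Site.shift e.1 e.2 ∧ p.2.1 = k then -(1 / 2 : ℂ) else 0) *
        ![(1 + euclideanGamma e.2) p.2.2 0, (1 + euclideanGamma e.2) p.2.2 1] δ with hbP
  set bQ : Fin 3 → Matrix (Fin 2) (TorusSite 4 L × Fin 3 × Fin 4) ℂ := fun k =>
    Matrix.of fun δ q =>
      ![(1 + euclideanGamma e.2) 0 q.2.2, (1 + euclideanGamma e.2) 1 q.2.2] δ *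
        (if q.1 = e.1 then star ((U e : Matrix (Fin 3) (Fin 3) ℂ) q.2.1 k) else 0) with hbQ
  -- the `θ`-independent part off the link `e`
  set W0 : Matrix (TorusSite 4 L × Fin 3 × Fin 4) (TorusSite 4 L × Fin 3 × Fin 4) ℂ :=
    Matrix.of fun p q =>
      (if p = q then ((m₀ + 4 : ℝ) : ℂ) else 0) -
        (1 / 2 : ℂ) * ∑ μ : Fin 4,
          ((if q.1 = Site.shift p.1 μ ∧ (p.1, μ) ≠ e then
              (1 - euclideanGamma μ) p.2.2 q.2.2 *
                (U (p.1, μ) : Matrix (Fin 3) (Fin 3) ℂ) p.2.1 q.2.1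
            else 0) +
           (if p.1 = Site.shift q.1 μ ∧ (q.1, μ) ≠ e then
              (1 + euclideanGamma μ) p.2.2 q.2.2 *
                star ((U (q.1, μ) : Matrix (Fin 3) (Fin 3) ℂ) q.2.1 p.2.1)
            else 0)) with hW0
  have hmul_f : ∀ k p q, (fP k * fQ k) p q =
      (if p.1 = e.1 then -(1 / 2 : ℂ) * (U e : Matrix (Fin 3) (Fin 3) ℂ) p.2.1 k else 0) *
        (if q.1 = Site.shift e.1 e.2 ∧ q.2.1 = k then 1 else 0) *
          (1 - euclideanGamma e.2) p.2.2 q.2.2 := fun k p q =>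
    of_mul_of_apply _ (oneSubGamma_apply_eq e.2) _ _ _ _ p q
  have hmul_b : ∀ k p q, (bP k * bQ k) p q =
      (if p.1 = Site.shift e.1 e.2 ∧ p.2.1 = k then -(1 / 2 : ℂ) else 0) *
        (if q.1 = e.1 then star ((U e : Matrix (Fin 3) (Fin 3) ℂ) q.2.1 k) else 0) *
          (1 + euclideanGamma e.2) p.2.2 q.2.2 := fun k p q =>
    of_mul_of_apply _ (oneAddGamma_apply_eq e.2) _ _ _ _ p q
  refine ⟨W0 + (fP 2 * fQ 2 + bP 2 * bQ 2), fP 0 * fQ 0 + bP 1 * bQ 1, fP 1 * fQ 1 + bP 0 * bQ 0,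
    (rank_add_le' _ _).trans (add_le_add (rank_mul_fin_two_le _ _) (rank_mul_fin_two_le _ _)),
    (rank_add_le' _ _).trans (add_le_add (rank_mul_fin_two_le _ _) (rank_mul_fin_two_le _ _)),
    fun θ => ?_⟩
  have hz : star (Complex.exp (θ * Complex.I)) = Complex.exp (-(θ * Complex.I)) := by
    rw [← starRingEnd_apply, ← Complex.exp_conj, map_mul, Complex.conj_ofReal, Complex.conj_I]
    ring_nf
  have hw : star (Complex.exp (-(θ * Complex.I))) = Complex.exp (θ * Complex.I) := by
    rw [← hz, star_star]
  ext p q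
  obtain ⟨x, a, α⟩ := p
  obtain ⟨y, b, β⟩ := q
  rw [wilsonDirac_update_apply, Submonoid.coe_mul, hT θ, Matrix.mul_diagonal, Matrix.mul_diagonal]
  -- protect the two projectors from `Matrix.add_apply`
  set Γm : Matrix (Fin 4) (Fin 4) ℂ := 1 - euclideanGamma e.2 with hΓm
  set Γp : Matrix (Fin 4) (Fin 4) ℂ := 1 + euclideanGamma e.2 with hΓp
  simp only [Matrix.add_apply, Matrix.smul_apply, smul_eq_mul, hmul_f, hmul_b, hW0, Matrix.of_apply]
  linear_combination
    fwd_hop_decomp (Complex.exp (θ * Complex.I)) (Complex.exp (-(θ * Complex.I)))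
        (Γm α β) ((U e : Matrix (Fin 3) (Fin 3) ℂ) a) b (x = e.1) (y = Site.shift e.1 e.2) +
      bwd_hop_decomp (Complex.exp (θ * Complex.I)) (Complex.exp (-(θ * Complex.I)))
        (Γp α β) hz hw ((U e : Matrix (Fin 3) (Fin 3) ℂ) b) a (x = Site.shift e.1 e.2) (y = e.1)


end Summit.QuantumFields.QCD.Theorems.PauliBandLimit

namespace Summit.QuantumFields.QCD.Theorems

/-- **Item `PauliBandLimit` of route `PauliWegnerSea` (stmt-QuantumFields-11514, card P1): the
Wilson determinant is band-limited of degree `≤ 4` along every one-link circle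
`U_e ↦ U_e · diag(e^{iθ}, e^{-iθ}, 1)`.**  For every torus, `SU(3)` background `U`, bare mass
`m₀`, edge `e` and family `T(θ)` with matrix `diag(e^{iθ}, e^{-iθ}, 1)` there are
`c₀, …, c₈ ∈ ℂ` with `det D_W(U[U_e ↦ U_e T(θ)]; m₀, 1) = ∑_{k=0}^{8} c_k e^{i(k-4)θ}` for all
`θ`.  Proof: the structure `D(θ) = A + e^{iθ} B + e^{-iθ} C` with `rank B, rank C ≤ 4`
(`wilsonDirac_update_decomp`: rank two of the Wilson projectors `1 ∓ γ_μ`) and the abstract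
degree bound `det_add_smul_add_smul_of_rank_le`. [folklore] -/
theorem PauliBandLimit_proof : Summit.QuantumFields.QCD.Theses.PauliWegnerSea.PauliBandLimit := by
  unfold Summit.QuantumFields.QCD.Theses.PauliWegnerSea.PauliBandLimit
  intro L _ U m₀ e T hT
  obtain ⟨A, B, C, hB, hC, hdec⟩ := PauliBandLimit.wilsonDirac_update_decomp U m₀ e T hT
  obtain ⟨c, hc⟩ := PauliBandLimit.det_add_smul_add_smul_of_rank_le A B C hB hC
  refine ⟨fun k => c k, fun θ => ?_⟩
  have hzw : Complex.exp (θ * Complex.I) * Complex.exp (-(θ * Complex.I)) = 1 := by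
    rw [← Complex.exp_add, add_neg_cancel, Complex.exp_zero]
  rw [hdec θ, hc _ _ hzw, Finset.mul_sum, ← Fin.sum_univ_eq_sum_range]
  refine Finset.sum_congr rfl fun k _ => ?_
  have hk : Complex.exp ((((k : ℕ) : ℝ) - 4 : ℝ) * θ * Complex.I) =
      Complex.exp (θ * Complex.I) ^ (k : ℕ) * Complex.exp (-(θ * Complex.I)) ^ 4 := by
    rw [← Complex.exp_nat_mul, ← Complex.exp_nat_mul, ← Complex.exp_add]
    congr 1
    push_cast
    ring
  rw [hk]
  ring

end Summit.QuantumFields.QCD.Theorems
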